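import Summits.QuantumFields.YangMills.Theorems.AllWindowsColdBoxBulkMidSandwichLocalisedScore

/-!
# The quadratic variance FLOOR, LOCALISED to the core (whitened frame, smooth potential)
# (crux idea `logconcave-core-extension` on ⟨stmt-QuantumFields-24006⟩ — the card's IDEA-NEEDED leaf
# «localised QCC on a convex body at the intrinsic `r_K`», floor half)

`floorWhitened_localised`: for `0 ≤ δ_K ≤ δ ≤ ½`, `H` symmetric, `b`, `A ∈ C²(ℝⁿ)` with the GLOBAL
second-difference sandwich `(1 ± δ)|h|²`, the centring `∫x_i e^{−A} = 0`, and the core Hessian pinching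
`(1 ± δ_K)|v|²` on a measurable `K`:

  `(1 − 17·ρ)·(2 tr H² + |b|²) ≤ gE(q²) − gE(q)²`,  `ρ := δ_K + δ·(μ_A(Kᶜ))^{1/4}`,

— the tree's `floorWhitened_of_contDiff` (constant `2δ`) with the global sandwich constant replaced by the
core constant up to the fourth root of the off-core Gibbs mass.  PROOF: the Hessian-explicit affine-dual
inequality `affine_dual_ineq_hess` with `u = Hx + b`, `c = gE(q)`, the localised Hessian integral, the
localised Cramér–Rao floor summed over the rows of `H`, and the off-core second moment.

HONEST SCOPE.  Free-hands work of the LEAD seat of ⟨stmt-QuantumFields-24006⟩ (FCL lineage) on an ingredient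
of an UN-TRIAGED crux idea card; classical log-concave probability.  No stub of LINE-18, no crux, rung or
summit is proved; the Yang–Mills mass gap is NOT proved by any of this.
-/

noncomputable section

namespace Summit.QuantumFields.YangMills.Theorems.SandwichVariancePinching

open MeasureTheory Real Filter Topology Set
open Summit.QuantumFields.YangMills.Cruxes.TransportCovarianceTransfer (contDiff_quadObs fderiv_quadObs trace_mul_self_of_isSymm dotProduct_mulVec_of_isSymm)

variable {n : ℕ}

/-- **FLOOR BOOKKEEPING**: with `ρ = δ_K + δ s` (`s ∈ [0,1]`, `s⁴Z = P`), the localised inputs give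
`(1 − 17ρ)(2τ + β)Z ≤ 4S₂ + 2βZ − τZ − ((1+δ_K)(S₂ + βZ) + (δ−δ_K)Xoff)`. [folklore] -/
theorem floor_algebra_localised {τ β Z S₂ Xoff δ δK s : ℝ} (hτ : 0 ≤ τ) (hβ : 0 ≤ β) (hZ : 0 ≤ Z)
    (hδ : 0 ≤ δ) (hδ2 : δ ≤ 1 / 2) (hδK : 0 ≤ δK) (hδKδ : δK ≤ δ) (hs0 : 0 ≤ s) (hs1 : s ≤ 1)
    (hXoff0 : 0 ≤ Xoff)
    (hCR : τ * ((1 - δK) * Z - (δ - δK) * (s ^ 4 * Z)) ≤ S₂)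
    (hX : Xoff ≤ 14 * (τ / (1 - δ) + β) * (Z * s ^ 2)) :
    (1 - 17 * (δK + δ * s)) * (2 * τ + β) * Z ≤
      4 * S₂ + 2 * (β * Z) - τ * Z - ((1 + δK) * (S₂ + β * Z) + (δ - δK) * Xoff) := by
  have ha : (1 - δ)⁻¹ ≤ 1 + 2 * δ := by
    rw [inv_le_comm₀ (by linarith) (by linarith)]
    have h : (1 + 2 * δ)⁻¹ * (1 + 2 * δ) = 1 := inv_mul_cancel₀ (by linarith)
    nlinarith [inv_nonneg.mpr (by linarith : (0:ℝ) ≤ 1 + 2 * δ)]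
  have hs4 : s ^ 4 ≤ s := by
    have : s ^ 4 ≤ s ^ 1 := pow_le_pow_of_le_one hs0 hs1 (by norm_num)
    simpa using this
  have hs2 : s ^ 2 ≤ s := by
    have : s ^ 2 ≤ s ^ 1 := pow_le_pow_of_le_one hs0 hs1 (by norm_num)
    simpa using this
  have hτZ : 0 ≤ τ * Z := mul_nonneg hτ hZ
  have hβZ : 0 ≤ β * Z := mul_nonneg hβ hZ
  set rZ : ℝ := (2 * τ + β) * Z with hrZ
  have hrZ0 : 0 ≤ rZ := by rw [hrZ]; positivity
  have hτr : τ * Z ≤ rZ := by rw [hrZ]; nlinarith only [hτ, hβ, hZ]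
  have hβr : β * Z ≤ rZ := by rw [hrZ]; nlinarith only [hτ, hβ, hZ]
  -- `Xoff ≤ 14 rZ s²`
  have hX' : Xoff ≤ 14 * rZ * s ^ 2 := by
    have h1 : τ / (1 - δ) + β ≤ 2 * τ + β := by
      rw [div_eq_mul_inv]; nlinarith only [mul_le_mul_of_nonneg_left ha hτ, hτ, hδ, hδ2]
    have := mul_le_mul_of_nonneg_right (mul_le_mul_of_nonneg_left h1 (by norm_num : (0:ℝ) ≤ 14))
      (by positivity : 0 ≤ Z * s ^ 2)
    rw [hrZ]; linarith
  -- `(3 − δK) S₂ ≥ (3 − δK) τ ((1−δK)Z − (δ−δK) s⁴ Z)`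
  have h3 : 0 ≤ 3 - δK := by linarith
  have hS : (3 - δK) * (τ * ((1 - δK) * Z - (δ - δK) * (s ^ 4 * Z))) ≤ (3 - δK) * S₂ :=
    mul_le_mul_of_nonneg_left hCR h3
  -- the error terms
  have e1 : (3 - δK) * ((δ - δK) * (s ^ 4 * Z)) * τ ≤ 3 * (δ * s) * rZ := by
    have h1 : (3 - δK) * ((δ - δK) * (s ^ 4 * Z)) ≤ 3 * (δ * (s * Z)) := by
      have p1 : (δ - δK) * (s ^ 4 * Z) ≤ δ * (s * Z) := by
        calc (δ - δK) * (s ^ 4 * Z) ≤ δ * (s ^ 4 * Z) := mul_le_mul_of_nonneg_right (by linarith) (by positivity)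
          _ ≤ δ * (s * Z) := mul_le_mul_of_nonneg_left (mul_le_mul_of_nonneg_right hs4 hZ) hδ
      have p0 : 0 ≤ (δ - δK) * (s ^ 4 * Z) := mul_nonneg (by linarith) (by positivity)
      nlinarith only [p1, p0, hδK, h3]
    have := mul_le_mul_of_nonneg_right h1 hτ
    calc (3 - δK) * ((δ - δK) * (s ^ 4 * Z)) * τ ≤ 3 * (δ * (s * Z)) * τ := this
      _ = 3 * (δ * s) * (τ * Z) := by ring
      _ ≤ 3 * (δ * s) * rZ := mul_le_mul_of_nonneg_left hτr (by positivity)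
  have e2 : (δ - δK) * Xoff ≤ 14 * (δ * s) * rZ := by
    calc (δ - δK) * Xoff ≤ δ * Xoff := mul_le_mul_of_nonneg_right (by linarith) hXoff0
      _ ≤ δ * (14 * rZ * s ^ 2) := mul_le_mul_of_nonneg_left hX' hδ
      _ ≤ δ * (14 * rZ * s) := mul_le_mul_of_nonneg_left (mul_le_mul_of_nonneg_left hs2 (by positivity)) hδ
      _ = 14 * (δ * s) * rZ := by ring
  have e3 : δK * (τ * Z) ≤ δK * rZ := mul_le_mul_of_nonneg_left hτr hδK
  have e4 : δK * (β * Z) ≤ δK * rZ := mul_le_mul_of_nonneg_left hβr hδK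
  -- expand and conclude
  have hexp : (3 - δK) * (τ * ((1 - δK) * Z - (δ - δK) * (s ^ 4 * Z))) =
      (3 - δK) * (1 - δK) * (τ * Z) - (3 - δK) * ((δ - δK) * (s ^ 4 * Z)) * τ := by ring
  have hquad : (2 - 4 * δK) * (τ * Z) ≤ (3 - δK) * (1 - δK) * (τ * Z) := by
    have : 2 - 4 * δK ≤ (3 - δK) * (1 - δK) := by nlinarith only [sq_nonneg δK]
    exact mul_le_mul_of_nonneg_right this hτZ
  have hgoal : (1 - 17 * (δK + δ * s)) * (2 * τ + β) * Z =
      2 * (τ * Z) + β * Z - 17 * δK * rZ - 17 * (δ * s) * rZ := by rw [hrZ]; ring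
  rw [hgoal]
  nlinarith only [hS, hexp, hquad, e1, e2, e3, e4, hδK, hrZ0, mul_nonneg hδK hrZ0,
    mul_nonneg (mul_nonneg hδ hs0) hrZ0]

/-- **THE LOCALISED VARIANCE FLOOR FOR A SMOOTH POTENTIAL IN THE WHITENED FRAME.**
For `0 ≤ δ_K ≤ δ ≤ ½`, `H` symmetric, `b ∈ ℝⁿ`, `A ∈ C²(ℝⁿ)` with the global second-difference sandwich
`(1 ± δ)|h|²`, the centring `∫x_i e^{−A} = 0`, and the core Hessian pinching `(1 ± δ_K)|v|²` on a measurable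
`K`: `(1 − 17(δ_K + δ·(∫_{Kᶜ}e^{−A}/∫e^{−A})^{1/4}))·(2 tr H² + |b|²) ≤ gE(q²) − gE(q)²`. [folklore] -/
theorem floorWhitened_localised {δ : ℝ} (hδ : 0 ≤ δ) (hδ2 : δ ≤ 1 / 2)
    (H : Matrix (Fin n) (Fin n) ℝ) (b : Fin n → ℝ) {A : (Fin n → ℝ) → ℝ} (hH : H.IsSymm)
    (hA : ContDiff ℝ 2 A)
    (hsw : ∀ x h : Fin n → ℝ, (1 - δ) * (h ⬝ᵥ h) ≤ A (x + h) + A (x - h) - 2 * A x ∧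
      A (x + h) + A (x - h) - 2 * A x ≤ (1 + δ) * (h ⬝ᵥ h))
    (hcent : ∀ i : Fin n, ∫ x, x i * exp (-A x) = 0)
    {K : Set (Fin n → ℝ)} (hK : MeasurableSet K) {δK : ℝ} (hδK : 0 ≤ δK) (hδKδ : δK ≤ δ)
    (hloc : ∀ x ∈ K, ∀ v : Fin n → ℝ, (1 - δK) * (v ⬝ᵥ v) ≤ fderiv ℝ (fderiv ℝ A) x v v ∧
      fderiv ℝ (fderiv ℝ A) x v v ≤ (1 + δK) * (v ⬝ᵥ v)) :
    (1 - 17 * (δK + δ * Real.sqrt (Real.sqrt ((∫ x in Kᶜ, exp (-A x)) / ∫ x, exp (-A x))))) *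
        (2 * (H * H).trace + b ⬝ᵥ b) ≤
      (∫ x, (x ⬝ᵥ H.mulVec x + b ⬝ᵥ x) * (x ⬝ᵥ H.mulVec x + b ⬝ᵥ x) * exp (-A x)) / (∫ x, exp (-A x)) -
        (∫ x, (x ⬝ᵥ H.mulVec x + b ⬝ᵥ x) * exp (-A x)) / (∫ x, exp (-A x)) *
          ((∫ x, (x ⬝ᵥ H.mulVec x + b ⬝ᵥ x) * exp (-A x)) / (∫ x, exp (-A x))) := by
  have hδ1 : δ < 1 := by linarith
  have hAc : Continuous A := hA.continuous
  obtain ⟨C₀, κ, _, hκ, hlb⟩ := exists_quadratic_lower_of_sandwich hAc hδ1 hsw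
  have hZint : Integrable fun x => exp (-A x) := by
    have := integrable_mul_exp_neg_of_growth hAc continuous_const hκ (by norm_num : 0 ≤ 8) hlb
      (w := fun _ => (1:ℝ)) (D := 1) (fun x => by simp)
    simpa using this
  have hZ : 0 < ∫ x, exp (-A x) := integral_exp_pos hZint
  set Z : ℝ := ∫ x, exp (-A x) with hZdef
  set P : ℝ := ∫ x in Kᶜ, exp (-A x) with hPdef
  have hP0 : 0 ≤ P := setIntegral_nonneg hK.compl fun x _ => (exp_pos _).le
  have hPZ : P ≤ Z := setIntegral_le_integral hZint (ae_of_all _ fun x => (exp_pos _).le)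
  -- the fourth root `s = (P/Z)^{1/4}`
  set s : ℝ := Real.sqrt (Real.sqrt (P / Z)) with hsdef
  have hr0 : 0 ≤ P / Z := div_nonneg hP0 hZ.le
  have hr1 : P / Z ≤ 1 := (div_le_one hZ).mpr hPZ
  have hs0 : 0 ≤ s := Real.sqrt_nonneg _
  have hss : s ^ 2 = Real.sqrt (P / Z) := Real.sq_sqrt (Real.sqrt_nonneg _)
  have hs1 : s ≤ 1 := by
    rw [hsdef, Real.sqrt_le_one]; exact Real.sqrt_le_one.mpr hr1
  have hs4 : s ^ 4 * Z = P := by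
    have : s ^ 4 = (s ^ 2) ^ 2 := by ring
    rw [this, hss, Real.sq_sqrt hr0]; field_simp
  have hsPZ : Real.sqrt (P * Z) = Z * s ^ 2 := by
    rw [hss]
    have e : P * Z = (P / Z) * Z ^ 2 := by field_simp
    rw [e, Real.sqrt_mul hr0, Real.sqrt_sq hZ.le]; ring
  -- the observable
  set q : (Fin n → ℝ) → ℝ := fun x => x ⬝ᵥ H.mulVec x + b ⬝ᵥ x with hqdef
  have hqc : ContDiff ℝ 1 q := contDiff_quadObs H b
  have hqd : ∀ x v, fderiv ℝ q x v = ((2:ℝ) • H.mulVec x + b) ⬝ᵥ v := fun x v => fderiv_quadObs hH b x v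
  obtain ⟨Dq, Dq', hDq0, hDq'0, hqb, hq'b⟩ := quadObs_growth hH b
  set S2 : ℝ := ∫ x, (H.mulVec x ⬝ᵥ H.mulVec x) * exp (-A x) with hS2def
  set Iq : ℝ := ∫ x, q x * exp (-A x) with hIqdef
  set Iqq : ℝ := ∫ x, q x * q x * exp (-A x) with hIqqdef
  set τ : ℝ := (H * H).trace with hτdef
  have hτ0 : 0 ≤ τ := by rw [hτdef, trace_mul_self_of_isSymm hH]; positivity
  have hτrows : (∑ i, H i ⬝ᵥ H i) = τ := by
    rw [hτdef, trace_mul_self_of_isSymm hH]; simp [dotProduct, sq]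
  have hbb : 0 ≤ b ⬝ᵥ b := by simpa using dotProduct_self_star_nonneg b
  set Xoff : ℝ := ∫ x in Kᶜ, ((H.mulVec x + b) ⬝ᵥ (H.mulVec x + b)) * exp (-A x) with hXoffdef
  have hXoff0 : 0 ≤ Xoff := setIntegral_nonneg hK.compl fun x _ =>
    mul_nonneg (by simpa using dotProduct_self_star_nonneg (H.mulVec x + b)) (exp_pos _).le
  -- integrability of the pieces
  obtain ⟨CH, hCH0, hCH⟩ := exists_norm_affine_le H 0
  have hn : (0:ℝ) ≤ n := Nat.cast_nonneg n
  have hIS2 : Integrable fun x => (H.mulVec x ⬝ᵥ H.mulVec x) * exp (-A x) := by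
    refine integrable_mul_exp_neg_of_growth hAc ((continuous_const.matrix_mulVec continuous_id).dotProduct
      (continuous_const.matrix_mulVec continuous_id)) hκ (by norm_num : 2 ≤ 8) hlb (D := (n : ℝ) * CH ^ 2) fun x => ?_
    rw [abs_of_nonneg (by simpa using dotProduct_self_star_nonneg (H.mulVec x))]
    have h2 : ‖H.mulVec x‖ ≤ CH * (1 + ‖x‖) := by simpa using hCH x
    have h3 : ‖H.mulVec x‖ ^ 2 ≤ CH ^ 2 * (1 + ‖x‖) ^ 2 := by
      rw [← mul_pow]; exact pow_le_pow_left₀ (norm_nonneg _) h2 2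
    nlinarith [dotProduct_self_le_card_mul_norm_sq (H.mulVec x), mul_le_mul_of_nonneg_left h3 hn]
  have hIq : Integrable fun x => q x * exp (-A x) :=
    integrable_mul_exp_neg_of_growth hAc hqc.continuous hκ (by norm_num) hlb hqb
  have hIqq : Integrable fun x => q x * q x * exp (-A x) :=
    integrable_mul_exp_neg_of_growth hAc (hqc.continuous.mul hqc.continuous) hκ
      (by norm_num : 3 + 3 ≤ 8) hlb (abs_mul_le_growth hqb hqb)
  have hIlin : ∀ w : Fin n → ℝ, Integrable fun x => (w ⬝ᵥ x) * exp (-A x) := fun w =>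
    integrable_mul_exp_neg_of_growth hAc (continuous_const.dotProduct continuous_id) hκ
      (by norm_num : 1 ≤ 8) hlb (abs_dotProduct_le_growth w)
  have hlin0 : ∀ w : Fin n → ℝ, ∫ x, (w ⬝ᵥ x) * exp (-A x) = 0 :=
    integral_dotProduct_mul_exp_neg_eq_zero hAc hδ1 hsw hcent
  -- localised Cramér–Rao summed over the rows of `H`
  have hCR : τ * ((1 - δK) * Z - (δ - δK) * (s ^ 4 * Z)) ≤ S2 := by
    have hrow := fun i : Fin n =>
      integral_sq_dotProduct_ge_localised hA hδ hδ1 hsw hK (fun x hx v => (hloc x hx v).2) (H i)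
    have hS2sum : S2 = ∑ i, ∫ x, (H i ⬝ᵥ x) ^ 2 * exp (-A x) := by
      rw [hS2def, ← integral_finsetSum]
      · congr 1; funext x
        rw [← Finset.sum_mul]
        congr 1
        simp [dotProduct, Matrix.mulVec, sq]
      · intro i _
        have hb := abs_mul_le_growth (abs_dotProduct_le_growth (H i)) (abs_dotProduct_le_growth (H i))
        refine integrable_mul_exp_neg_of_growth hAc ((continuous_const.dotProduct continuous_id).pow 2)
          hκ (by norm_num : 1 + 1 ≤ 8) hlb (D := (∑ j, |H i j|) * (∑ j, |H i j|)) (fun x => ?_)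
        rw [sq]; exact hb x
    rw [hS2sum, ← hτrows, Finset.sum_mul, hs4]
    exact Finset.sum_le_sum fun i _ => by
      have h := hrow i
      rw [← hZdef, ← hPdef] at h
      exact h
  -- the off-core second moment
  have hXoffle : Xoff ≤ 14 * (τ / (1 - δ) + b ⬝ᵥ b) * (Z * s ^ 2) := by
    have h := setIntegral_affine_normSq_le hA hδ1 hsw hcent H b hK.compl
    rw [← hZdef, ← hPdef, hτrows, hsPZ] at h
    exact h
  -- the Hessian-explicit affine-dual inequality for `q` with `u = Hx + b`, `c = Iq / Z`
  have key := affine_dual_ineq_hess hA hδ hδ1 hsw H b hqc hqb hq'b (Iq / Z)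
  have hdu : ∀ x, fderiv ℝ q x (H.mulVec x + b) =
      2 * (H.mulVec x ⬝ᵥ H.mulVec x) + (((2:ℝ) • H.mulVec b + H.mulVec b) ⬝ᵥ x) + (b ⬝ᵥ b) := by
    intro x
    rw [hqd]
    have e1 : H.mulVec x ⬝ᵥ b = H.mulVec b ⬝ᵥ x := by
      rw [← dotProduct_mulVec_of_isSymm hH x b, dotProduct_comm]
    have e2 : b ⬝ᵥ H.mulVec x = H.mulVec b ⬝ᵥ x := dotProduct_mulVec_of_isSymm hH b x
    simp only [add_dotProduct, dotProduct_add, smul_dotProduct, smul_eq_mul, e1, e2]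
    ring
  have hIdu : ∫ x, fderiv ℝ q x (H.mulVec x + b) * exp (-A x) = 2 * S2 + (b ⬝ᵥ b) * Z := by
    have e : (fun x => fderiv ℝ q x (H.mulVec x + b) * exp (-A x)) = fun x =>
        2 * ((H.mulVec x ⬝ᵥ H.mulVec x) * exp (-A x)) +
          ((((2:ℝ) • H.mulVec b + H.mulVec b) ⬝ᵥ x) * exp (-A x)) + (b ⬝ᵥ b) * exp (-A x) := by
      funext x; rw [hdu]; ring
    have hI1 : Integrable fun x => 2 * ((H.mulVec x ⬝ᵥ H.mulVec x) * exp (-A x)) +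
        ((((2:ℝ) • H.mulVec b + H.mulVec b) ⬝ᵥ x) * exp (-A x)) := (hIS2.const_mul 2).add (hIlin _)
    have hI2 : Integrable fun x => (b ⬝ᵥ b) * exp (-A x) := hZint.const_mul _
    rw [e, integral_add hI1 hI2, integral_add (hIS2.const_mul 2) (hIlin _), integral_const_mul,
      integral_const_mul, hlin0]
    ring
  have hHess := integral_hess_affine_le_localised hA hδ hδ1 hsw hK (fun x hx v => (hloc x hx v).2) H b
  rw [integral_affine_normSq_eq hA hδ1 hsw hcent hH b, ← hS2def, ← hZdef, ← hXoffdef] at hHess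
  -- evaluate `∫ (q − c)² e^{−A}`
  have hIvar : ∫ x, (q x - Iq / Z) ^ 2 * exp (-A x) = Iqq - Iq ^ 2 / Z := by
    have e : (fun x => (q x - Iq / Z) ^ 2 * exp (-A x)) = fun x =>
        q x * q x * exp (-A x) - (2 * (Iq / Z)) * (q x * exp (-A x)) + (Iq / Z) ^ 2 * exp (-A x) := by
      funext x; ring
    have hI1 : Integrable fun x => q x * q x * exp (-A x) - (2 * (Iq / Z)) * (q x * exp (-A x)) :=
      hIqq.sub (hIq.const_mul _)
    have hI2 : Integrable fun x => (Iq / Z) ^ 2 * exp (-A x) := hZint.const_mul _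
    rw [e, integral_add hI1 hI2, integral_sub hIqq (hIq.const_mul _), integral_const_mul,
      integral_const_mul]
    rw [← hIqqdef, ← hIqdef, ← hZdef]
    field_simp
    ring
  rw [hIdu, hIvar, ← hτdef, ← hZdef] at key
  -- bookkeeping
  have halg := floor_algebra_localised hτ0 hbb hZ.le hδ hδ2 hδK hδKδ hs0 hs1 hXoff0 hCR hXoffle
  have hmain : (1 - 17 * (δK + δ * s)) * (2 * τ + b ⬝ᵥ b) * Z ≤ Iqq - Iq ^ 2 / Z := by
    linarith [halg, key, hHess]
  have hfrac : Iqq / Z - Iq / Z * (Iq / Z) = (Iqq - Iq ^ 2 / Z) / Z := by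
    field_simp
  rw [hfrac, le_div_iff₀ hZ]
  exact hmain

end Summit.QuantumFields.YangMills.Theorems.SandwichVariancePinching

end
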